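import Summits.AtomisticToContinuum.BoseEinsteinCondensation.Theses.BECStronglyRayleigh
import Summits.AtomisticToContinuum.BoseEinsteinCondensation.Theorems.InsertionFieldDelocalisation.Negative.Tightness
import Summits.AtomisticToContinuum.BoseEinsteinCondensation.Theorems.InsertionFieldDelocalisation.Negative.LoadBearing
import Summits.AtomisticToContinuum.BoseEinsteinCondensation.Theorems.BECStronglyRayleighGroundStateStability
import HarnessLib

/-!
# Line `mobile-trap-dirichlet-eigenfunction` — crux `BECStronglyRayleigh.InsertionFieldDelocalisation`
# (stmt-AtomisticToContinuum-9673, "K1")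

Skeleton (crux-plan, round 1, generation 1) of the crux-idea card `mobile-trap-dirichlet-eigenfunction`
(crux-ideate ideator 1; triage r1-1 / r1-2 / r1-3: pass, pass, pass — sharpenings answered below and
in `Lines/mobile-trap-dirichlet-eigenfunction.md`).

THE CRUX. One constant `M` such that for every `L ≥ 2`, every `2 ≤ N ≤ L³/2` and every entrywise
nonnegative sector-`N` ground vector `ψ` of the hard-core boson / ferro-XY Hamiltonian `xyTorus 3 L 1`
on `(ℤ/Lℤ)³`, the two-particle insertion field `r^T_x = Σ_y Re ψ(1_{T∪{x,y}})` (`|T| = N-2`) obeys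
`L³ Σ_T [Σ_x (r^T_x)³/Σ_x r^T_x + ‖r^T‖⁴/(Σ_x r^T_x)²] ≤ M Σ_T ‖r^T‖²` — the size-biased (weights
`W(T,x) = (r^T_x)²`) mean of the normalised insertion profile `L³ q_T(x) = L³ r^T_x / Σ_y r^T_y` is
`O(1)` uniformly in the filling `ν = N/L³ ≤ ½` (`Negative.insertionFieldDelocalisation_iff`).

THE LINE — the insertion field is the principal DIRICHLET EIGENFUNCTION of one random walker among
`N-1` mobile, reversible, stationary hard traps (the other bosons), killed on contact; its eigenvalue is
the chemical-potential excess `δ_N = E(N) - E(N-1) + 3`, which a CONVEXITY theorem pins at `O(ν)`;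
K1 is then annealed anti-localisation: the only way to enhance the eigenfunction at `x` is a trap-free
void around `x`; a void of radius `R` gains at most `e^{cδR²} ≤ e^{c'νR²}` (survival for the exit
time) and costs `e^{-c″νR³}` (emptiness formation), and cube beats square with a DENSITY-FREE critical
void after the substitution `R = ν^{-1/3}s` — which is why ONE constant serves every filling `≤ ½`.

* ENGINE → CONVEXITY (`stub_convexity`, L; the card's first lemma, the Literature-grade by-product all
  three triagers asked to have landed): `2E(N) ≤ E(N+1) + E(N-1)` for the sector ground energies of
  `xyTorus 3 L 1`. Proof route: the Gibbs semigroup `e^{-τH}` maps every vector with stable occupation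
  polynomial to one (LANDED: `StableConeVariationalSelection.stub_trotterClosure` fed by
  `stub_eulerGate`/`stub_eulerLimit`/`stub_siteFactor`, `Theorems/BECStronglyRayleighGroundStateStability*`);
  apply it to `v_w(1_S) = w^{|S|}` (polynomial `Π_x(1 + w z_x)`); a real stable multi-affine polynomial
  with nonnegative coefficients is Rayleigh (`Δ_xy ≥ 0` at real points, bivariate specialisation);
  scaling `z_T → ∞`, `z_rest → 0⁺` in `∂_xQ ∂_yQ ≥ Q ∂_x∂_yQ` gives the negative lattice condition
  `F(T∪x)F(T∪y) ≥ F(T)F(T∪{x,y})`, `F = e^{-τH}1`, with constant ONE; `τ → ∞` and Perron positivity in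
  the three sectors force `E(N+1) + E(N-1) ≥ 2E(N)`. Two-site check: second difference `1 - Δ`, so
  the window is exactly Theorem S's `|Δ| ≤ 1`; toy j009506: 0/80 violations inside, 32/80 at `Δ = 1.01`.
* CONVEXITY → EXCESS BOUND (`stub_excessBound`, M): `δ_N ≤ C·N/L³` for `2 ≤ N ≤ L³/2`
  (`μ_N ≤ (E(2N) - E(N))/N ≤ (E_flat(2N) + 3N)/N`, `E ≥ -3N`, `E_flat(n) = -3n(L³-n)/(L³-1)`, whence
  `δ_N ≤ 6(2N-1)/(L³-1) ≤ 12 N/L³` for `L ≥ 3`; `L = 2` has degree 3 and is checked with `E ≥ -3N/2`).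
  This is the ONLY place the eigenvalue of the trap problem is made small, and the first place
  `2N ≤ L³` is consumed (`Negative.insertionFieldDelocalisation_false_without_halfFilling`).
* THE LEVER, ALGEBRAIC FACE (`stub_embedding`, M): the exact TWO-BODY EMBEDDING of an eigenvector,
  `(H^{(bg)} ⊗ 1 + 1 ⊗ h - E) Ψ = -D` for `Ψ(T,x) = Re ψ(1_{T∪x})·[x ∉ T]`, with source
  `D(T,x) = [x ∈ T] Σ_{y∼x} Ψ(T,y) ≥ 0` living on the contact set only — the eigen-equation READ on
  (background, tagged particle) pairs; it is what makes `Ψ/ψ'` a Dirichlet eigenfunction of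
  (Doob background process) ⊗ (rate-½ walk) killed on contact, with eigenvalue `δ_N`
  (`Negative.insertionFieldDelocalisation_false_without_groundState`: the line uses `Hψ = Eψ` HERE).
  Checked numerically to `1e-15` (j009506, embedding residual).
* VOID TAIL (`stub_voidTail`, XL): under the size-biased law `W = (r^T_x)²` the distance `ρ_T(x)` from
  the insertion site to the nearest background particle has tail `P_W(ρ > R) ≤ C₁ e^{-c₁ ν R³}` — an
  emptiness-formation bound for the QUADRATIC (physical-type) measure, the "measure knot" of
  Ideator1-Notes §C (pair level proved-grade: PhysicalAntibunching; linear amplitude measures: NA from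
  Theorem S).
* ANNEALED GAIN (`stub_annealedGain`, XL, HARDEST, load-bearing): conditionally on `ρ_T(x) = R` the
  size-biased mean of `L³ q_T(x)` is `≤ C₂ e^{c₂ ν R²}` — Feynman–Kac for the Dirichlet eigenfunction
  (gain `e^{δ·(exit time ≍ R²)}`, `δ ≤ Cν` by the excess bound) plus annealing (traps refill a void no
  slower than diffusively; beyond the healing length `ξ ≍ ν^{-1/2}` the true gain is `≍ ν^{1/2}R`, so
  the allowance over-estimates — harmless for an upper bound, triage r1-3). It must absorb PARTIAL
  mesoscopic deficits around `x` at every scale by the same cost/gain count (triage r1-1/r1-2; the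
  bookkeeping template is card `dyadic-shell-summability` (S2)); at bounded `R` it is the crux
  restricted to void-free insertion sites (triage r1-1) — the claim of the line is precisely that THIS
  is the easy regime and the Lifshitz voids are the whole difficulty. Second consumer of `2N ≤ L³`
  (room: `L³ q ≥ L³/(L³-N+2)`, cf. `Negative.K1_floor`).
* TRANSFER (`stub_transfer`, M–L): disintegrate `E_W[L³q]` by `ρ`, Abel-sum the gain against the tail:
  `E_W[L³q] ≤ C₂ Σ_R e^{c₂νR²} P_W(ρ = R) ≤ C₂(1 + Σ_{m≥0} c₂ν(2m+1)e^{c₂ν(m+1)²} min(1, C₁e^{-c₁νm³}))`,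
  bounded uniformly in `ν ≤ ½` after `m = ν^{-1/3}s` (cost exponent `s³` is `ν`-free, gain exponent
  `ν^{1/3}s²` is not); output `ThirdMomentBound`: `L³ Σ_T Σ_x(r^T_x)³/Σ_x r^T_x ≤ M' Σ_T ‖r^T‖²`.

Composition (sorry-free, kernel-checked): `InsertionFieldDelocalisation_of` takes the six registered
stubs (keyed BY NAME through the `Registered.stub_*` aliases, the device of the GroundStateStability
lines) and concludes `Summit.AtomisticToContinuum.BoseEinsteinCondensation.Theses.BECStronglyRayleigh.InsertionFieldDelocalisation`
BY NAME: `ThirdMomentBound := stub_transfer stub_voidTail (stub_annealedGain stub_embedding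
(stub_excessBound stub_convexity))`, and the in-file Cauchy–Schwarz reduction
`K1lhs r ≤ 2·Σr³/Σr` (`K1lhs_le_two_mul_M3`, from the landed `Negative.sq_sum_sq_le_sum_mul_sum_cube`,
`x/0 = 0` consistent) turns `M'` into the crux constant `M = 2M'`
(`insertionFieldDelocalisationAt_of_thirdMomentBound`, `Negative.insertionFieldDelocalisation_iff`).

DISPROOF OBLIGATIONS (`Cruxes/InsertionFieldDelocalisation/Disproof.lean`, cdisprove v3, re-read at plan
time; landed as `Theorems/InsertionFieldDelocalisation/Negative/{Toolkit,PerronExistence,LoadBearing,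
Tightness}.lean`, imported here): `_false_without_groundState` — the eigen-equation is consumed at
`stub_embedding` (it IS `Hψ = Eψ`) and through it at `stub_annealedGain` (for the frozen pair `δ_{1_{ab}}`
the `R = 0` shell of `AnnealedGain` already fails: `L³·Σr³/Σr = L³` against `C₂‖r‖² = 2C₂`), and at
`stub_convexity`/`stub_voidTail` (ground = Perron sector vector); `_false_without_halfFilling` —
`2N ≤ L³` is consumed at `stub_excessBound` (`E(2N)` must exist) and at `stub_annealedGain` (at `N = L³`
the two-hole field has `L³q = L³/2` with NO void: the all-up witness kills `AnnealedGain` at `R = 1`, as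
it must); tightness `four_le_const` / `not_insertionFieldDelocalisationAt_of_lt_four` — no explicit
constant is claimed (`M = 2M'`, `M'` existential); `K1_ceiling`/`insertionFieldDelocalisation_bounded_sides`
— only `L → ∞` is at stake, and every stub is uniform in `L`. No `-- Targets` stub of this line is an
instance of a landed Negative lemma; `ledger negatives`: the BEC entries (BECSwapAffinity.SwapJensen,
BECPopovBerryRG.BerryStiffPhaseLRO) concern neither insertion fields nor sector energies.

Conventions (as in the crux and in `Negative.Toolkit`): occupied = spin up = `Fin`-index `0`;
`1_S = fun x => if x ∈ S then 0 else 1`; the sector of `N` bosons has magnetisation `N - L³/2`;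
`field ψ T x` is the crux's `r^T_x` verbatim; `x/0 = 0` throughout (a vanishing field contributes `0`
to both sides of every inequality below).
-/

noncomputable section

namespace Summit.AtomisticToContinuum.BoseEinsteinCondensation.Cruxes.InsertionFieldDelocalisation.MobileTrapDirichletEigenfunction

open scoped BigOperators
open Literature.MathematicalPhysics.QuantumLattice Literature.Probability.LatticeModels
open Summit.AtomisticToContinuum.BoseEinsteinCondensation.Theses.BECStronglyRayleigh
  (InsertionFieldDelocalisation GroundStateStability)
open Summit.AtomisticToContinuum.BoseEinsteinCondensation.Theorems.InsertionFieldDelocalisation.Negative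
  (field K1lhs K1rhs K1Ineq InsertionFieldDelocalisationAt insertionFieldDelocalisation_iff
    sq_sum_sq_le_sum_mul_sum_cube field_nonneg field_eq_zero_of_mem)

/-! ## Objects -/

section Objects

/-- The occupation configuration of `S` — literally the crux's `fun x => if x ∈ S then 0 else 1`. -/
def ind {Λ : Type*} [DecidableEq Λ] (S : Finset Λ) : TensorIndex Λ 2 := fun x => if x ∈ S then 0 else 1

/-- The real amplitude `Re ψ(1_S)`. -/
def amp {Λ : Type*} [DecidableEq Λ] (ψ : TensorIndex Λ 2 → ℂ) (S : Finset Λ) : ℝ := (ψ (ind S)).re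

/-- The ONE-particle insertion field `Ψ(T,x) = u_T(x) = Re ψ(1_{T ∪ {x}}) · [x ∉ T]` (background `T`,
tagged particle at `x`; the hard core between tag and background is the indicator). For `|T| = N-2`
the crux's two-particle field is `r^T_x = Σ_y Ψ(T ∪ {x}, y)·[x ∉ T]` (`field_eq_sum_ins`, informal). -/
def ins {Λ : Type*} [DecidableEq Λ] (ψ : TensorIndex Λ 2 → ℂ) (T : Finset Λ) (x : Λ) : ℝ :=
  if x ∉ T then amp ψ (insert x T) else 0

/-- `E(k)`: the lowest energy of `xyTorus 3 L 1` in the sector of `k` bosons (magnetisation `k - L³/2`),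
exactly the crux's `lowestEnergyInSector 1 (xyTorus 3 L 1) ((k : ℝ) - (L : ℝ) ^ 3 / 2)`. -/
abbrev secE (L : ℕ) [NeZero L] (k : ℕ) : ℝ :=
  lowestEnergyInSector 1 (xyTorus 3 L 1) ((k : ℝ) - (L : ℝ) ^ 3 / 2)

/-- The TRAPPING RATE `δ_N = E(N) - E(N-1) + 3` (chemical-potential excess over the free value `-3`):
the principal Dirichlet eigenvalue of one walker among `N-1` mobile traps. -/
def trapRate (L : ℕ) [NeZero L] (N : ℕ) : ℝ := secE L N - secE L (N - 1) + 3

/-- The crux's hypotheses on `ψ`, bundled: a nonzero, entrywise real-nonnegative vector of the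
`N`-boson sector with `Hψ = E(N)ψ` (by sector Perron–Frobenius this is THE Perron ray). -/
def IsCruxGround (L : ℕ) [NeZero L] (N : ℕ) (ψ : TensorIndex (TorusSite 3 L) 2 → ℂ) : Prop :=
  ψ ∈ spinZSector 1 ((N : ℝ) - (L : ℝ) ^ 3 / 2) ∧ ψ ≠ 0 ∧
    (xyTorus 3 L 1).mulVec ψ = ((secE L N : ℝ) : ℂ) • ψ ∧ ∀ σ, 0 ≤ (ψ σ).re ∧ (ψ σ).im = 0

/-- The VOID RADIUS `ρ_T(x)`: graph distance on the torus from the insertion site `x` to the nearest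
particle of the background `T` (`0` for `T = ∅`, so the `N = 2` data sit in the shell `ρ = 0`; for
`T ≠ ∅`, `ρ_T(x) = 0 ↔ x ∈ T`, where the field vanishes). -/
def voidRadius {L : ℕ} (T : Finset (TorusSite 3 L)) (x : TorusSite 3 L) : ℕ :=
  (T.image fun t => (torusGraph 3 L).dist x t).min.untopD 0

/-- The size-biased third-moment functional `Σ_x r³ / Σ_x r` (`= Σ_x r_x² · (r_x/Σr)`: the `r²`-weighted
mean of the normalised profile `q = r/Σr`, times `Σ r²`). `K1lhs r ≤ 2 · M3 r` (`K1lhs_le_two_mul_M3`). -/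
def M3 {ι : Type*} [Fintype ι] (r : ι → ℝ) : ℝ := (∑ x, r x ^ 3) / ∑ x, r x

end Objects

/-! ## The six statements of the line -/

/-- STATEMENT 1 — **convexity of the sector ground energies in the particle number** (torus, pure
hopping; the general-graph `|Δ| ≤ 1`-with-fields version is the Literature-grade theorem and has the same
proof): `2E(N) ≤ E(N+1) + E(N-1)` for `1 ≤ N ≤ L³ - 1`. Proof route (all inputs in tree): stability
preservation by `e^{-τH}` (`StableConeVariationalSelection.stub_trotterClosure` + `stub_eulerGate` +
`stub_eulerLimit` + `stub_siteFactor`, landed) applied to `v_w(1_S) = w^{|S|}`; real stable multi-affine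
with nonnegative coefficients ⇒ Rayleigh (`rayleighDiff`, bivariate specialisation via
`isRealStable_iff_line`); scaling limit ⇒ NLC `F(T∪x)F(T∪y) ≥ F(T)F(T∪{x,y})` for `F = e^{-τH}1` with
constant `1`; `τ → ∞` with sector Perron–Frobenius (`stub_sectorPerron`, landed;
`perronFrobenius_groundState_pos`) in the sectors `N-1, N, N+1`. Sharp: two sites give second
difference `1 - Δ`. Toy j009506: 0/80 violations on random graphs with fields for every `|Δ| ≤ 1`. -/
def SectorEnergyConvexity : Prop :=
  ∀ (L : ℕ) [NeZero L], 2 ≤ L → ∀ N : ℕ, 1 ≤ N → N + 1 ≤ L ^ 3 →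
    2 * secE L N ≤ secE L (N + 1) + secE L (N - 1)

/-- STATEMENT 2 — **the trapping rate is `O(ν)` at every filling `≤ ½`**: one constant `C` with
`δ_N = E(N) - E(N-1) + 3 ≤ C · N/L³` for all `L ≥ 2`, `2 ≤ N ≤ L³/2` (the card's
`ChemicalPotentialExcessBound`, with `C = 12`: convexity makes the increments `μ_k = E(k) - E(k-1)`
nondecreasing, so `N μ_N ≤ E(2N) - E(N) ≤ E_flat(2N) + 3N` with the flat trial state on `2N`-sets,
`E_flat(n) = -3n(L³-n)/(L³-1)` (`L ≥ 3`; degree `3` and `E ≥ -3N/2` at `L = 2`), `E(N) ≥ -3N`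
(six moves per particle, each `-½`), i.e. `δ_N ≤ 6(2N-1)/(L³-1) ≤ 12N/L³ ⟺ 2N ≤ L³`). Measured:
`δ_N/ν = 2.5–4.8` on `3³`, `4³` (j009506). -/
def ExcessBound : Prop :=
  ∃ C : ℝ, ∀ (L : ℕ) [NeZero L], 2 ≤ L → ∀ N : ℕ, 2 ≤ N → 2 * N ≤ L ^ 3 →
    trapRate L N ≤ C * N / (L : ℝ) ^ 3

/-- STATEMENT 3 — **the two-body embedding of an eigenvector** (exact, all `T`, all `x`; the lever's
algebraic face): for `Hψ = Eψ`, `H = xyTorus 3 L 1` (`(Hψ)(1_S) = -½ Σ_{S'∼S} ψ(1_{S'})`, one allowed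
nearest-neighbour move), the one-particle insertion field `Ψ(T,x) = Re ψ(1_{T∪x})[x ∉ T]` satisfies
`-½ Σ_{t∈T} Σ_{b∉T, b∼t} Ψ(T-t+b, x) - ½ Σ_{y∼x} Ψ(T,y) - E·Ψ(T,x) = -[x ∈ T]·Σ_{y∼x} Ψ(T,y)`:
off the contact set it is the eigen-equation at `S = T ∪ x` (moves of the tag ↔ `1 ⊗ h`, moves of the
background avoiding `x` ↔ `H^{(bg)} ⊗ 1`, the move `b = x` is excluded automatically by the indicator),
on it both hopping terms produce the same contact sum `D(T,x) = Σ_{y∼x} Ψ(T,y) ≥ 0`. Summing over `x`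
gives `(H^{(N-1)} - E - 3)R = -ξ` (`OverlapContactIdentity` of `IdeatorSketch1`); dividing by the
background Perron vector gives the Doob / Dirichlet-eigenfunction face. Residual `≤ 1.1e-15` in ED
(j009506, `L = 2,3,4`; `4×4`, `6×6`). -/
def TwoBodyEmbedding : Prop :=
  ∀ (L : ℕ) [NeZero L] (E : ℝ) (ψ : TensorIndex (TorusSite 3 L) 2 → ℂ),
    (xyTorus 3 L 1).mulVec ψ = (E : ℂ) • ψ →
    ∀ (T : Finset (TorusSite 3 L)) (x : TorusSite 3 L),
      -(1 / 2 : ℝ) * (∑ t ∈ T, ∑ b : TorusSite 3 L,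
          if b ∉ T ∧ (torusGraph 3 L).Adj t b then ins ψ (insert b (T.erase t)) x else 0)
        - (1 / 2 : ℝ) * (∑ y : TorusSite 3 L, if (torusGraph 3 L).Adj x y then ins ψ T y else 0)
        - E * ins ψ T x
      = -(if x ∈ T then ∑ y : TorusSite 3 L, (if (torusGraph 3 L).Adj x y then ins ψ T y else 0)
          else 0)

/-- STATEMENT 4 — **void tail under the size-biased law** (A3 of the card): there are `C₁` and `c₁ > 0`
such that for every admissible `(L, N, ψ)` and every `R`,
`Σ_{(T,x) : ρ_T(x) > R} (r^T_x)² ≤ C₁ e^{-c₁ (N/L³) R³} Σ_{(T,x)} (r^T_x)²` — the probability, under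
`W ∝ (r^T_x)²`, that the insertion site sits in a void of radius `> R` decays like an emptiness-formation
probability with the POISSON-order exponent `ν R³` (ball volume `≍ R³` for `R ≲ L`). Why plausibly
true: under the uniform law it is `C(L³-|B_R|, N-2)/C(L³, N-2) ≤ e^{-ν|B_R|}`; under the
amplitude-LINEAR measures negative association (Theorem S, proved) gives the same; the `W`-tilt towards
voids is at most the gain `e^{2c₂νR²}`, and cube beats square (constants absorb `R ≤ 4c₂/c₁`). Why it
might fail / what is open: the tail is for a QUADRATIC functional of the amplitudes (the measure knot);
hyperuniformity of the condensate only helps. `N = 2`: `T = ∅`, `ρ = 0`, the left side is `0`. -/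
def VoidTail : Prop :=
  ∃ C₁ c₁ : ℝ, 0 < c₁ ∧ ∀ (L : ℕ) [NeZero L], 2 ≤ L → ∀ N : ℕ, 2 ≤ N → 2 * N ≤ L ^ 3 →
    ∀ ψ : TensorIndex (TorusSite 3 L) 2 → ℂ, IsCruxGround L N ψ → ∀ R : ℕ,
      (∑ T ∈ (Finset.univ : Finset (TorusSite 3 L)).powersetCard (N - 2), ∑ x : TorusSite 3 L,
          if R < voidRadius T x then field ψ T x ^ 2 else 0)
        ≤ C₁ * Real.exp (-(c₁ * ((N : ℝ) / (L : ℝ) ^ 3) * (R : ℝ) ^ 3)) *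
          ∑ T ∈ (Finset.univ : Finset (TorusSite 3 L)).powersetCard (N - 2), ∑ x : TorusSite 3 L,
            field ψ T x ^ 2

/-- STATEMENT 5 — **annealed gain** (A4 of the card; THE HARDEST, load-bearing): there are `C₂, c₂`
such that for every admissible `(L, N, ψ)` and every shell `ρ_T(x) = R`,
`Σ_{ρ=R} (r^T_x)² · (L³ r^T_x / Σ_y r^T_y) ≤ C₂ e^{c₂ (N/L³) R²} Σ_{ρ=R} (r^T_x)²`: conditionally on the
nearest background particle being at distance `R`, the size-biased mean of the normalised profile
`L³ q_T(x)` is at most the survival gain of the Dirichlet eigenfunction for the exit time `≍ R²` of the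
void at killing rate `δ ≤ Cν` (STATEMENTS 2–3 are its inputs: Feynman–Kac
`g(T,x) = e^{δt} E_{(T,x)}[g(T_t,X_t); τ_c > t]` for the Doob face of the embedding, then annealing —
traps and walker mix once the void is crossed). `R = 0` is the `N = 2` shell (flat pair field,
`L³ Σr³/Σr = L³c² ≤ C₂ L³c²`) and, for `T ≠ ∅`, the zero terms `x ∈ T`. Why it might fail: the
conditioning is on `ρ` alone, so the estimate must absorb PARTIALLY depleted mesoscopic regions around
`x` by the same cost/gain count at every scale (Jastrow caricature: deficit `δν` on radius `R'` gains
`≍ δν R'`, costs `≍ (δν)² R'³/ν` — harmless in `d = 3`, fatal in `d = 1`), and slow sound modes of the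
background could spoil the annealed Harnack step; at bounded `R` the statement is the crux restricted
to void-free insertion sites. Beyond `ξ ≍ ν^{-1/2}` the true gain is `≍ ν^{1/2}R` (sound-speed refill),
so `e^{c₂νR²}` over-estimates — harmless. Requires `2N ≤ L³` (room: `L³q ≥ L³/(L³-N+2)`). -/
def AnnealedGain : Prop :=
  ∃ C₂ c₂ : ℝ, ∀ (L : ℕ) [NeZero L], 2 ≤ L → ∀ N : ℕ, 2 ≤ N → 2 * N ≤ L ^ 3 →
    ∀ ψ : TensorIndex (TorusSite 3 L) 2 → ℂ, IsCruxGround L N ψ → ∀ R : ℕ,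
      (∑ T ∈ (Finset.univ : Finset (TorusSite 3 L)).powersetCard (N - 2), ∑ x : TorusSite 3 L,
          if voidRadius T x = R then
            field ψ T x ^ 2 * ((L : ℝ) ^ 3 * field ψ T x / ∑ y : TorusSite 3 L, field ψ T y)
          else 0)
        ≤ C₂ * Real.exp (c₂ * ((N : ℝ) / (L : ℝ) ^ 3) * (R : ℝ) ^ 2) *
          ∑ T ∈ (Finset.univ : Finset (TorusSite 3 L)).powersetCard (N - 2), ∑ x : TorusSite 3 L,
            if voidRadius T x = R then field ψ T x ^ 2 else 0

/-- STATEMENT 6's OUTPUT — the crux in its size-biased third-moment form: one `M'` with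
`L³ Σ_T (Σ_x (r^T_x)³ / Σ_x r^T_x) ≤ M' Σ_T ‖r^T‖²` for all admissible data. Equivalent to the crux up
to the factor `2` (`Σr³/Σr ≤ K1lhs r ≤ 2Σr³/Σr`, Cauchy–Schwarz); it is NOT a stub — it is what the
transfer delivers and what the composition converts. -/
def ThirdMomentBound : Prop :=
  ∃ M' : ℝ, ∀ (L : ℕ) [NeZero L], 2 ≤ L → ∀ N : ℕ, 2 ≤ N → 2 * N ≤ L ^ 3 →
    ∀ ψ : TensorIndex (TorusSite 3 L) 2 → ℂ, IsCruxGround L N ψ →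
      (L : ℝ) ^ 3 * ∑ T ∈ (Finset.univ : Finset (TorusSite 3 L)).powersetCard (N - 2), M3 (field ψ T)
        ≤ M' * ∑ T ∈ (Finset.univ : Finset (TorusSite 3 L)).powersetCard (N - 2), K1rhs (field ψ T)

/-! ## Registered stubs -/

/-- STUB 1 (L). Convexity of `N ↦ E(N)` on the XY torus, from the landed stability-preserving
semigroup. See `SectorEnergyConvexity`. -/
theorem stub_convexity : SectorEnergyConvexity := by
  sorry

/-- STUB 2 (M). Convexity ⇒ the trapping rate is `O(ν)`: `δ_N ≤ C N/L³` for `2 ≤ N ≤ L³/2`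
(telescoping + flat trial state + `E ≥ -3N`). See `ExcessBound`. -/
theorem stub_excessBound : SectorEnergyConvexity → ExcessBound := by
  sorry

/-- STUB 3 (M). The exact two-body embedding of an eigenvector of `xyTorus 3 L 1` (finite bookkeeping
over the occupation-basis action `-½·[one allowed move]`). See `TwoBodyEmbedding`. -/
theorem stub_embedding : TwoBodyEmbedding := by
  sorry

/-- STUB 4 (XL). Void tail `P_W(ρ > R) ≤ C₁e^{-c₁νR³}` under the size-biased law. See `VoidTail`. -/
theorem stub_voidTail : VoidTail := by
  sorry

/-- STUB 5 (XL; HARDEST, LOAD-BEARING). Annealed gain `E_W[L³q | ρ = R] ≤ C₂e^{c₂νR²}` from the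
embedding (Feynman–Kac / Dirichlet eigenfunction among mobile traps) and the excess bound (`δ ≤ Cν`).
See `AnnealedGain`. -/
theorem stub_annealedGain : TwoBodyEmbedding → ExcessBound → AnnealedGain := by
  sorry

/-- STUB 6 (M–L). The transfer `(A3) ∧ (A4) ⇒ C`: disintegration by the void radius and Abel summation
of the gain against the tail, uniform in `ν ≤ ½` after `R = ν^{-1/3}s`. See `ThirdMomentBound`. -/
theorem stub_transfer : VoidTail → AnnealedGain → ThirdMomentBound := by
  sorry

/-! ## Name-keyed aliases of the six stub statements (hypotheses of the composition)

`Registered.stub_X` is the statement of `stub_X` under the registered stub's short name, so that the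
native skeleton audit (hypotheses admissible iff registered stubs BY NAME) accepts
`InsertionFieldDelocalisation_of : Registered.stub_convexity → … → InsertionFieldDelocalisation`
(device of `Cruxes/GroundStateStability/Lines/*.lean`). -/
namespace Registered

/-- Alias of `SectorEnergyConvexity` keyed by the registered stub name. -/
abbrev stub_convexity : Prop := SectorEnergyConvexity
/-- Alias of the statement of `stub_excessBound`. -/
abbrev stub_excessBound : Prop := SectorEnergyConvexity → ExcessBound
/-- Alias of `TwoBodyEmbedding` keyed by the registered stub name. -/
abbrev stub_embedding : Prop := TwoBodyEmbedding
/-- Alias of `VoidTail` keyed by the registered stub name. -/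
abbrev stub_voidTail : Prop := VoidTail
/-- Alias of the statement of `stub_annealedGain`. -/
abbrev stub_annealedGain : Prop := TwoBodyEmbedding → ExcessBound → AnnealedGain
/-- Alias of the statement of `stub_transfer`. -/
abbrev stub_transfer : Prop := VoidTail → AnnealedGain → ThirdMomentBound

end Registered

/-! ## Proved glue -/

section Glue

/-- **Cauchy–Schwarz reduction of the crux functional**: for `r ≥ 0`,
`Σr³/Σr + (Σr²)²/(Σr)² ≤ 2·Σr³/Σr` (`(Σr²)² ≤ (Σr)(Σr³)`, landed as
`Negative.sq_sum_sq_le_sum_mul_sum_cube`; both sides `0` when `Σr = 0`). -/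
theorem K1lhs_le_two_mul_M3 {ι : Type*} [Fintype ι] (r : ι → ℝ) (hr : ∀ i, 0 ≤ r i) :
    K1lhs r ≤ 2 * M3 r := by
  unfold K1lhs M3
  have hcs := sq_sum_sq_le_sum_mul_sum_cube r hr
  by_cases h0 : ∑ i, r i = 0
  · simp [h0]
  · have hpos : 0 < ∑ i, r i :=
      lt_of_le_of_ne (Finset.sum_nonneg fun i _ => hr i) (Ne.symm h0)
    have hkey : (∑ i, r i ^ 2) ^ 2 / (∑ i, r i) ^ 2 ≤ (∑ i, r i ^ 3) / ∑ i, r i := by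
      rw [div_le_div_iff₀ (by positivity) hpos]
      calc (∑ i, r i ^ 2) ^ 2 * ∑ i, r i ≤ ((∑ i, r i) * ∑ i, r i ^ 3) * ∑ i, r i :=
            mul_le_mul_of_nonneg_right hcs hpos.le
        _ = (∑ i, r i ^ 3) * (∑ i, r i) ^ 2 := by ring
    linarith

/-- **The third-moment form implies the crux at constant `2M'`** (unfolded form
`∃ M, InsertionFieldDelocalisationAt M` of `Negative.insertionFieldDelocalisation_iff`; the crux BY NAME
is concluded only by `InsertionFieldDelocalisation_of`). -/
theorem insertionFieldDelocalisationAt_of_thirdMomentBound (h : ThirdMomentBound) :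
    ∃ M : ℝ, InsertionFieldDelocalisationAt M := by
  obtain ⟨M', hM'⟩ := h
  refine ⟨2 * M', ?_⟩
  intro L _ hL N hN hNL ψ hψ hne heig hnn
  have key := hM' L hL N hN hNL ψ ⟨hψ, hne, heig, hnn⟩
  have hnn' : ∀ σ, 0 ≤ (ψ σ).re := fun σ => (hnn σ).1
  have hsum : ∑ T ∈ (Finset.univ : Finset (TorusSite 3 L)).powersetCard (N - 2), K1lhs (field ψ T)
      ≤ 2 * ∑ T ∈ (Finset.univ : Finset (TorusSite 3 L)).powersetCard (N - 2), M3 (field ψ T) := by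
    rw [Finset.mul_sum]
    exact Finset.sum_le_sum fun T _ => K1lhs_le_two_mul_M3 _ (field_nonneg ψ hnn' T)
  have hL0 : (0 : ℝ) ≤ (L : ℝ) ^ 3 := by positivity
  have hmul := mul_le_mul_of_nonneg_left hsum hL0
  unfold K1Ineq
  linarith

end Glue

/-! ## The composition: the six stubs imply the crux, by name -/

/-- **`InsertionFieldDelocalisation` from the six stubs** (no `sorry`). STUB 1 (convexity) feeds STUB 2
(`δ ≤ Cν`); STUB 3 (embedding) and STUB 2 feed STUB 5 (annealed gain); STUB 4 (void tail) and STUB 5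
feed STUB 6 (transfer), whose output `ThirdMomentBound` is converted into the crux with constant
`M = 2M'` by the proved Cauchy–Schwarz reduction. -/
theorem InsertionFieldDelocalisation_of (h1 : Registered.stub_convexity)
    (h2 : Registered.stub_excessBound) (h3 : Registered.stub_embedding)
    (h4 : Registered.stub_voidTail) (h5 : Registered.stub_annealedGain)
    (h6 : Registered.stub_transfer) : InsertionFieldDelocalisation := by
  have hE : ExcessBound := h2 h1
  have hG : AnnealedGain := h5 h3 hE
  have hT : ThirdMomentBound := h6 h4 hG
  exact insertionFieldDelocalisation_iff.mpr (insertionFieldDelocalisationAt_of_thirdMomentBound hT)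

/-- Wiring check: the registered stubs feed `InsertionFieldDelocalisation_of` as stated. -/
example : InsertionFieldDelocalisation :=
  InsertionFieldDelocalisation_of stub_convexity stub_excessBound stub_embedding stub_voidTail
    stub_annealedGain stub_transfer

/-- Availability check of the inputs named in the line card: Theorem S (the crux's dependency) is
PROVED in the tree, so stubs needing negative association / Perron structure import it rather than
assume it. -/
example : GroundStateStability :=
  Summit.AtomisticToContinuum.BoseEinsteinCondensation.Theorems.GroundStateStability_proof

end Summit.AtomisticToContinuum.BoseEinsteinCondensation.Cruxes.InsertionFieldDelocalisation.MobileTrapDirichletEigenfunction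

end
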